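import Literature.MathematicalPhysics.QuantumLattice.HubbardTTPrimeGrandCanonicalEnergyDensity
import Literature.MathematicalPhysics.QuantumLattice.HubbardNNNHoppingRemovalCost
import Literature.MathematicalPhysics.QuantumLattice.HubbardFillingBoxChemicalPotentialCell
import Literature.MathematicalPhysics.QuantumLattice.HubbardNNNHoppingClusterEmbedding
import HarnessLib

/-!
# The grand-canonical ground-state energy of the `t–t'` Hubbard torus converges to the Legendre
# transform `p(μ)` of the energy density — with an explicit `O(L)` floor at every finite size

Family `hubbard` (topic `MathematicalPhysics/QuantumLattice`); namespace
`Literature.MathematicalPhysics.QuantumLattice.ThermodynamicLimit`. This file supplies the identification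
that `HubbardTTPrimeGrandCanonicalEnergyDensity.lean` ("Not here: the identification with the thermodynamic
limit of the grand-canonical TORUS ground-state energies `E₀(H − μN)/L²`") and
`HubbardGrandCanonicalDensity.lean` ("NOT here: the thermodynamic limit itself") leave open. With
`E_L(M) = groundEnergy (hubbardTorusTT' L t t' U) M` the canonical sector energies of the `L × L` torus,
`e = energyDensityTT' t t' U` their thermodynamic limit per site and
`p(μ) = gcEnergyDensityTT' t t' U μ = inf_{0 ≤ m < 2} (e(m) − μ m)` (Ruelle 1969 §3.4), for `U ≥ 0`:

* §1 GENERIC SECTOR FLOOR (any finite orbital set, any particle-conserving `H`): a common lower bound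
  `F ≤ E_H(N) − μN` over ALL sectors `N ≤ 2|Λ|` is a lower bound of the quadratic form of `H − μN̂` on the
  whole Fock space (`mul_re_dotProduct_le_re_dotProduct_gc_of_forall_sector`, block diagonality in `N̂`:
  `ψ = Σ_N P_N ψ`), hence of `Matrix.groundEnergy (H − μN̂)` (`le_groundEnergy_gc_of_forall_sector`);
  conversely `Matrix.groundEnergy (H − μN̂) ≤ E_H(N) − μN` for every sector (`groundEnergy_gc_le_sector`).
* §2 THE EXPLICIT FLOOR («gcFloor»): for EVERY `μ`, `L ≥ 1`, `M ≤ 2L²`,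
  `p(μ) L² − (16|t| + 32|t'|) L − (54(2|t| + |U| + 2|t'|) + 2|μ|) ≤ E_L(M) − μM`
  (`gcFloor_hubbardTorusTT'`): even `M < 2L²` by the tiling floor `energyDensityTT'_le_torus` and
  `p ≤ e(m) − μm`; odd `M` and the full band `M = 2L²` are moved to an even neighbour by the volume-uniform
  one-particle addition / removal costs (`groundEnergy_hubbardRectTorusTT'_square_add_le`,
  `groundEnergy_twoGraph_pred_le`; constant `K = 18(2|t| + |U| + 2|t'|)`). Fock-space forms: for every
  vector `ψ`, `(floor)·‖ψ‖² ≤ Re⟨ψ, (H_L − μN̂)ψ⟩` (`gcFloor_hubbardTorusTT'_re_dotProduct`, unit form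
  `gcFloor_hubbardTorusTT'_unit` — the `hfloor` hypothesis shape of
  `VariationalStationarity.abs_im_expect_commutator_le_sqrt` with `Q = 1`), and
  `floor ≤ Matrix.groundEnergy (H_L − μN̂)` (`gcFloor_le_groundEnergy_hubbardTorusTT'_gc`).
* §3 THE LIMIT: `Matrix.groundEnergy (hubbardTorusTT' L t t' U − μN̂)/L² → p(μ)`
  (`tendsto_groundEnergy_gc_hubbardTorusTT'_div_sq`; the limsup half from `tendsto_energyDensityTT'_torus`
  in the sector `rectN m L` of a near-minimising density `m`), and at `t' = 0` the tree's grand-canonical torus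
  `Matrix.groundEnergy (hubbardTorusWith 2 L t U μ)/L² → p(t,0,U,μ)`
  (`tendsto_groundEnergy_hubbardTorusWith_div_sq` — the hypothesis shape of
  `HubbardGrandCanonicalDensity.tendsto_gcDensity_of_hasDerivAt`, now a theorem).
* §4 AT A SUPPORTING SLOPE: for `0 < n < 2` and `μ ∈ [μ₋(n), μ₊(n)]` (`mem_Icc_chemPot_iff_isMinOn`),
  `p(μ) = e(n) − μn` (`gcEnergyDensityTT'_eq_of_mem_Icc_chemPot`), so the floor reads
  `(e(n) − μn) L² − O(L)` (`gcFloor_hubbardTorusTT'_of_mem_Icc_chemPot`): a vector of the torus whose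
  `H − μN̂` energy is `(e(n) − μn)L² + o(L²)` has excess `o(L²)` over the GLOBAL Fock-space floor — the
  input of the Pusz–Woronowicz stationarity bound for CHARGED (particle-number changing) perturbations.

Everything is PROVED; no definition, no named fact, no sorry. The degree bound of the diagonal bond graph
of the rectangular torus is re-proved privately (it is private in `HubbardNNNHoppingThermodynamicLimit` /
`HubbardNNNHoppingRemovalCost`). Not here: `T > 0`; the value of `p`; differentiability of `p` (density
jumps), which `tendsto_gcDensity_of_hasDerivAt` still takes as a hypothesis.

## References

* D. Ruelle, *Statistical Mechanics: Rigorous Results* (1969), §3.4 (equivalence of the canonical and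
  grand-canonical thermodynamic functions: the grand potential is the Legendre transform of the energy /
  free energy in the density; continuity in the density). [cite: Ruelle1969, §3.4]
* H. Tasaki, *Physics and Mathematics of Quantum Many-Body Systems* (2020), §2.1 (variational
  characterisation of ground-state energies). [cite: Tasaki2020, §2.1]
-/

noncomputable section

namespace Literature.MathematicalPhysics.QuantumLattice

open Matrix Finset HubbardWave0 Literature.Probability.LatticeModels ThermodynamicLimit
open _root_.Filter
open scoped _root_.Topology ComplexOrder BigOperators

namespace ThermodynamicLimit

/-! ### §1 Generic sector floor for a particle-conserving Hamiltonian -/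

section SectorFloor

variable {Λ : Type*} [LinearOrder Λ] [Fintype Λ]

/-- The number distribution of a vector: `Σ_{N ≤ 2|Λ|} ⟨P_N ψ, P_N ψ⟩ = ⟨ψ, ψ⟩`. [folklore] -/
private theorem sum_range_dotProduct_numberProj_mulVec (ψ : Fock (Orb Λ)) :
    ∑ N ∈ range (Fintype.card (Orb Λ) + 1),
        star (numberProj N *ᵥ ψ) ⬝ᵥ (numberProj N *ᵥ ψ) = star ψ ⬝ᵥ ψ := by
  calc ∑ N ∈ range (Fintype.card (Orb Λ) + 1), star (numberProj N *ᵥ ψ) ⬝ᵥ (numberProj N *ᵥ ψ)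
      = ∑ N ∈ range (Fintype.card (Orb Λ) + 1), star ψ ⬝ᵥ (numberProj N *ᵥ ψ) :=
        Finset.sum_congr rfl fun N _ => (dotProduct_numberProj_mulVec N ψ).symm
    _ = star ψ ⬝ᵥ (∑ N ∈ range (Fintype.card (Orb Λ) + 1), numberProj N *ᵥ ψ) := by
        rw [dotProduct_sum]
    _ = star ψ ⬝ᵥ ψ := by rw [sum_numberProj_mulVec]

/-- The mean of the number distribution of a vector: `Σ_{N ≤ 2|Λ|} N ⟨P_N ψ, P_N ψ⟩ = ⟨ψ, N̂ ψ⟩`.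
[folklore] -/
private theorem sum_range_mul_dotProduct_numberProj_mulVec (ψ : Fock (Orb Λ)) :
    ∑ N ∈ range (Fintype.card (Orb Λ) + 1),
        (N : ℂ) * (star (numberProj N *ᵥ ψ) ⬝ᵥ (numberProj N *ᵥ ψ)) =
      star ψ ⬝ᵥ ((totalNumber : Matrix (Finset (Orb Λ)) (Finset (Orb Λ)) ℂ) *ᵥ ψ) := by
  rw [← sum_range_smul_numberProj_eq_totalNumber (Λ := Λ), Matrix.sum_mulVec, dotProduct_sum]
  refine Finset.sum_congr rfl fun N _ => ?_
  rw [smul_mulVec, dotProduct_smul, smul_eq_mul, dotProduct_numberProj_mulVec]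

/-- Block diagonality: for `H` commuting with `N̂`, `⟨ψ, Hψ⟩ = Σ_{N ≤ 2|Λ|} ⟨P_N ψ, H P_N ψ⟩`.
[folklore] -/
private theorem dotProduct_mulVec_eq_sum_range_numberProj (H : Matrix (Finset (Orb Λ)) (Finset (Orb Λ)) ℂ)
    (hHN : Commute H totalNumber) (ψ : Fock (Orb Λ)) :
    star ψ ⬝ᵥ (H *ᵥ ψ) = ∑ N ∈ range (Fintype.card (Orb Λ) + 1),
      star (numberProj N *ᵥ ψ) ⬝ᵥ (H *ᵥ (numberProj N *ᵥ ψ)) := by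
  conv_lhs => rw [← sum_numberProj_mulVec ψ]
  rw [star_sum, sum_dotProduct, mulVec_sum]
  refine Finset.sum_congr rfl fun N _ => ?_
  rw [dotProduct_sum]
  refine Finset.sum_eq_single N (fun M _ hMN => ?_) (fun h => absurd (by assumption) h)
  exact dotProduct_eq_zero_of_isNParticle_ne (isNParticle_numberProj_mulVec N ψ)
    (LiebTwo.isNParticle_mulVec_of_commute (isNParticle_numberProj_mulVec M ψ) hHN.symm.eq) (Ne.symm hMN)

/-- **Generic grand-canonical sector floor.** Let `H` conserve the particle number on the Fock space
of a finite orbital set and let `F ≤ E_H(N) − μN` for every sector `N ≤ 2|Λ|`. Then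
`F · ⟨ψ, ψ⟩ ≤ Re⟨ψ, (H − μN̂) ψ⟩` for EVERY Fock vector `ψ` (decompose `ψ = Σ_N P_N ψ`; `H − μN̂` is block
diagonal and bounded below by `E_H(N) − μN` on the `N`-th block). [cite: Ruelle1969, §3.4] -/
theorem mul_re_dotProduct_le_re_dotProduct_gc_of_forall_sector
    (H : Matrix (Finset (Orb Λ)) (Finset (Orb Λ)) ℂ) (hHN : Commute H totalNumber) (μ F : ℝ)
    (hF : ∀ N ∈ range (Fintype.card (Orb Λ) + 1), F ≤ groundEnergy H N - μ * N) (ψ : Fock (Orb Λ)) :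
    F * (star ψ ⬝ᵥ ψ).re ≤
      (star ψ ⬝ᵥ ((H - (μ : ℂ) • (totalNumber : Matrix (Finset (Orb Λ)) (Finset (Orb Λ)) ℂ)) *ᵥ ψ)).re := by
  set R := range (Fintype.card (Orb Λ) + 1) with hR
  set w : ℕ → ℝ := fun N => (star (numberProj N *ᵥ ψ) ⬝ᵥ (numberProj N *ᵥ ψ)).re with hw
  have hw0 : ∀ N, 0 ≤ w N := fun N =>
    (Complex.nonneg_iff.1 (dotProduct_star_self_nonneg (numberProj N *ᵥ ψ))).1
  -- the three decompositions, real parts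
  have h1 : (star ψ ⬝ᵥ ψ).re = ∑ N ∈ R, w N := by
    rw [← sum_range_dotProduct_numberProj_mulVec ψ, Complex.re_sum]
  have hN : (star ψ ⬝ᵥ ((totalNumber : Matrix (Finset (Orb Λ)) (Finset (Orb Λ)) ℂ) *ᵥ ψ)).re =
      ∑ N ∈ R, (N : ℝ) * w N := by
    rw [← sum_range_mul_dotProduct_numberProj_mulVec ψ, Complex.re_sum]
    refine Finset.sum_congr rfl fun N _ => ?_
    rw [show ((N : ℂ)) = ((N : ℝ) : ℂ) by norm_cast, Complex.re_ofReal_mul]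
  have hH : (star ψ ⬝ᵥ (H *ᵥ ψ)).re =
      ∑ N ∈ R, (star (numberProj N *ᵥ ψ) ⬝ᵥ (H *ᵥ (numberProj N *ᵥ ψ))).re := by
    rw [dotProduct_mulVec_eq_sum_range_numberProj H hHN ψ, Complex.re_sum]
  have hsplit : (star ψ ⬝ᵥ ((H - (μ : ℂ) • (totalNumber : Matrix (Finset (Orb Λ)) (Finset (Orb Λ)) ℂ))
      *ᵥ ψ)).re = (star ψ ⬝ᵥ (H *ᵥ ψ)).re -
        μ * (star ψ ⬝ᵥ ((totalNumber : Matrix (Finset (Orb Λ)) (Finset (Orb Λ)) ℂ) *ᵥ ψ)).re := by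
    rw [sub_mulVec, smul_mulVec, dotProduct_sub, dotProduct_smul, Complex.sub_re, smul_eq_mul,
      Complex.re_ofReal_mul]
  rw [hsplit, hH, hN, h1, Finset.mul_sum, Finset.mul_sum, ← Finset.sum_sub_distrib]
  refine Finset.sum_le_sum fun N hNR => ?_
  have hsec := re_dotProduct_mulVec_ge_groundEnergy H (isNParticle_numberProj_mulVec N ψ)
  have hFN := hF N hNR
  have hwN := hw0 N
  calc F * w N ≤ (groundEnergy H N - μ * N) * w N := mul_le_mul_of_nonneg_right hFN hwN
    _ = groundEnergy H N * w N - μ * ((N : ℝ) * w N) := by ring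
    _ ≤ _ := by linarith [hsec]

/-- `N̂` is Hermitian (diagonal with natural-number entries in the occupation basis). [folklore] -/
private theorem isHermitian_totalNumber_aux :
    (totalNumber : Matrix (Finset (Orb Λ)) (Finset (Orb Λ)) ℂ).IsHermitian := by
  rw [totalNumber_eq_diagonal_card, Matrix.IsHermitian, diagonal_conjTranspose]
  congr 1
  funext s
  simp

/-- `H − μN̂` is Hermitian when `H` is. [folklore] -/
private theorem isHermitian_sub_smul_totalNumber {H : Matrix (Finset (Orb Λ)) (Finset (Orb Λ)) ℂ}
    (hH : H.IsHermitian) (μ : ℝ) :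
    (H - (μ : ℂ) • (totalNumber : Matrix (Finset (Orb Λ)) (Finset (Orb Λ)) ℂ)).IsHermitian := by
  refine hH.sub ?_
  rw [Matrix.IsHermitian, conjTranspose_smul, (isHermitian_totalNumber_aux (Λ := Λ)).eq, Complex.star_def,
    Complex.conj_ofReal]

/-- A positive-semidefinite lower bound is a ground-energy lower bound: `A − c·1 ⪰ 0 ⇒ c ≤ E₀(A)`
(evaluate in the tracial ground state of `A`; private copy of the lemma of `FreeFermiGasNoDWaveOrder`,
not imported here). [cite: Tasaki2020, §2.1] -/
private theorem le_groundEnergy_of_posSemidef_sub_aux {n : Type*} [Fintype n] [DecidableEq n] [Nonempty n]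
    {A : Matrix n n ℂ} (hA : A.IsHermitian) {c : ℝ} (h : (A - (c : ℂ) • (1 : Matrix n n ℂ)).PosSemidef) :
    c ≤ A.groundEnergy := by
  have h0 := Matrix.groundStateFunctional_nonneg_of_posSemidef A h
  rw [map_sub, LinearMap.map_smul_of_tower, Matrix.groundStateFunctional_hamiltonian hA,
    Matrix.groundStateFunctional_one hA] at h0
  obtain ⟨hre, -⟩ := Complex.nonneg_iff.mp h0
  simp only [Complex.sub_re, Complex.ofReal_re, smul_eq_mul, mul_one] at hre
  linarith

/-- **A common sector floor bounds the grand-canonical ground energy from below**: for Hermitian `H`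
commuting with `N̂` and `F ≤ E_H(N) − μN` for all `N ≤ 2|Λ|`, `F ≤ E₀(H − μN̂)` (`Matrix.groundEnergy`,
the least eigenvalue on the full Fock space). [cite: Ruelle1969, §3.4] -/
theorem le_groundEnergy_gc_of_forall_sector (H : Matrix (Finset (Orb Λ)) (Finset (Orb Λ)) ℂ)
    (hH : H.IsHermitian) (hHN : Commute H totalNumber) (μ F : ℝ)
    (hF : ∀ N ∈ range (Fintype.card (Orb Λ) + 1), F ≤ groundEnergy H N - μ * N) :
    F ≤ Matrix.groundEnergy (H - (μ : ℂ) • (totalNumber : Matrix (Finset (Orb Λ)) (Finset (Orb Λ)) ℂ)) := by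
  classical
  set K := H - (μ : ℂ) • (totalNumber : Matrix (Finset (Orb Λ)) (Finset (Orb Λ)) ℂ) with hK
  have hKh : K.IsHermitian := isHermitian_sub_smul_totalNumber hH μ
  have hherm : (K - (F : ℂ) • (1 : Matrix (Finset (Orb Λ)) (Finset (Orb Λ)) ℂ)).IsHermitian := by
    refine hKh.sub ?_
    rw [Matrix.IsHermitian, conjTranspose_smul, conjTranspose_one, Complex.star_def, Complex.conj_ofReal]
  refine le_groundEnergy_of_posSemidef_sub_aux hKh (Matrix.PosSemidef.of_dotProduct_mulVec_nonneg hherm fun x => ?_)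
  have him := im_dotProduct_mulVec_self_of_isHermitian hherm x
  rw [Complex.nonneg_iff]
  refine ⟨?_, him.symm⟩
  have h := mul_re_dotProduct_le_re_dotProduct_gc_of_forall_sector H hHN μ F hF x
  rw [sub_mulVec, dotProduct_sub, Complex.sub_re, smul_mulVec, one_mulVec, dotProduct_smul, smul_eq_mul,
    Complex.re_ofReal_mul, sub_nonneg]
  exact h

/-- **The grand-canonical ground energy lies below every sector**: for Hermitian `H` and every
non-empty sector `N ≤ 2|Λ|`, `E₀(H − μN̂) ≤ E_H(N) − μN` (a unit `N`-particle trial vector of energy close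
to `E_H(N)` has `H − μN̂` energy close to `E_H(N) − μN`). [cite: Tasaki2020, §2.1] -/
theorem groundEnergy_gc_le_sector (H : Matrix (Finset (Orb Λ)) (Finset (Orb Λ)) ℂ) (hH : H.IsHermitian)
    (μ : ℝ) {N : ℕ} (hN : N ≤ Fintype.card (Orb Λ)) :
    Matrix.groundEnergy (H - (μ : ℂ) • (totalNumber : Matrix (Finset (Orb Λ)) (Finset (Orb Λ)) ℂ)) ≤
      groundEnergy H N - μ * N := by
  set K := H - (μ : ℂ) • (totalNumber : Matrix (Finset (Orb Λ)) (Finset (Orb Λ)) ℂ) with hK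
  have hKh : K.IsHermitian := isHermitian_sub_smul_totalNumber hH μ
  rw [le_sub_iff_add_le]
  refine le_csInf (groundEnergySet_nonempty H hN) ?_
  rintro E ⟨ψ, hψN, hψ1, rfl⟩
  have hray := Matrix.groundEnergy_le_rayleigh_holds hKh ψ hψ1
  have hKψ : (star ψ ⬝ᵥ (K *ᵥ ψ)).re = (expect H ψ).re - μ * N := by
    rw [hK, sub_mulVec, smul_mulVec, totalNumber_mulVec_of_isNParticle hψN, dotProduct_sub, dotProduct_smul,
      dotProduct_smul, hψ1, Complex.sub_re, smul_eq_mul, smul_eq_mul, mul_one, expect,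
      show ((μ : ℂ) * (N : ℂ)).re = μ * N by
        rw [show ((N : ℂ)) = ((N : ℝ) : ℂ) by norm_cast, ← Complex.ofReal_mul, Complex.ofReal_re]]
  linarith [hray, hKψ]

end SectorFloor

/-! ### §2 The explicit floor on the `t–t'` torus -/

section Torus

/-- Every site of `ℤ/aℤ × ℤ/bℤ` has at most four diagonal neighbours (private copy of the lemma of
`HubbardNNNHoppingThermodynamicLimit`, private there). [folklore] -/
private theorem card_filter_diag_adj_le_aux (a b : ℕ) (p : Fin a ×ₗ Fin b) :
    #{q | (fermionRectTorusDiagGraph a b).Adj p q} ≤ 4 := by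
  set x : ℕ := ((ofLex p).1 : ℕ) with hx
  set y : ℕ := ((ofLex p).2 : ℕ) with hy
  calc #{q | (fermionRectTorusDiagGraph a b).Adj p q}
      ≤ #({((x + 1) % a, (y + 1) % b), ((x + 1) % a, (y + (b - 1)) % b),
            ((x + (a - 1)) % a, (y + 1) % b), ((x + (a - 1)) % a, (y + (b - 1)) % b)} :
          Finset (ℕ × ℕ)) := by
        refine Finset.card_le_card_of_injOn (fun q => (((ofLex q).1 : ℕ), ((ofLex q).2 : ℕ))) ?_ ?_
        · intro q hq
          rw [Finset.mem_coe, Finset.mem_filter, fermionRectTorusDiagGraph_adj_iff] at hq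
          simp only [Finset.coe_insert, Finset.coe_singleton, Set.mem_insert_iff,
            Set.mem_singleton_iff, Prod.mk.injEq]
          obtain ⟨-, ⟨-, h1 | h1⟩, ⟨-, h2 | h2⟩⟩ := hq
          · exact Or.inl ⟨h1.symm, h2.symm⟩
          · exact Or.inr (Or.inl ⟨h1.symm, eq_mod_of_succ_mod_eq (ofLex p).2.isLt (ofLex q).2.isLt h2⟩)
          · exact Or.inr (Or.inr (Or.inl
              ⟨eq_mod_of_succ_mod_eq (ofLex p).1.isLt (ofLex q).1.isLt h1, h2.symm⟩))
          · exact Or.inr (Or.inr (Or.inr ⟨eq_mod_of_succ_mod_eq (ofLex p).1.isLt (ofLex q).1.isLt h1,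
              eq_mod_of_succ_mod_eq (ofLex p).2.isLt (ofLex q).2.isLt h2⟩))
        · intro q _ q' _ h
          simp only [Prod.mk.injEq] at h
          exact ofLex.injective (Prod.ext (Fin.ext h.1) (Fin.ext h.2))
    _ ≤ 4 := Finset.card_le_four

/-- **One-particle removal on the rectangular `L × L` `t–t'` torus**: `E(N − 1) ≤ E(N) + K · 2L²/N` for
`1 ≤ N ≤ 2L²`, `K = 18(2|t| + |U| + 2|t'|)` (both bond graphs of degree `≤ 4`;
`groundEnergy_twoGraph_pred_le`). [cite: Ruelle1969, §3.4] -/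
theorem groundEnergy_hubbardRectTorusTT'_square_pred_le (L : ℕ) (t t' U : ℝ) {N : ℕ} (hN1 : 1 ≤ N)
    (hN : N ≤ 2 * L ^ 2) :
    groundEnergy (hubbardRectTorusTT' L L t t' U) (N - 1) ≤
      groundEnergy (hubbardRectTorusTT' L L t t' U) N +
        18 * (2 * |t| + |U| + 2 * |t'|) * (2 * (L : ℝ) ^ 2) / N := by
  have hN' : N ≤ 2 * Fintype.card (Fin L ×ₗ Fin L) := by rw [card_rectSites]; nlinarith [hN]
  have := groundEnergy_twoGraph_pred_le (fermionRectTorusGraph L L) (fermionRectTorusDiagGraph L L)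
    (Δ := 4) (Δ' := 4) (card_filter_fermionRectTorusGraph_adj_le L L) (card_filter_diag_adj_le_aux L L)
    t U t' 0 hN1 hN'
  unfold hubbardRectTorusTT'
  refine this.trans (le_of_eq ?_)
  rw [card_rectSites, abs_zero]
  push_cast
  ring

/-- The floor in an EVEN sector below the full band, on the rectangular torus: for `L ≥ 1` and
`m < L²`, `p(μ) L² − (16|t| + 32|t'|) L ≤ E_{L×L}(2m) − 2μm` (tiling floor `energyDensityTT'_le` at the
density `2m/L² ∈ [0, 2)` and `p(μ) ≤ e(2m/L²) − μ · 2m/L²`). [cite: Ruelle1969, §3.4] -/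
theorem gcFloor_hubbardRectTorusTT'_even (t t' : ℝ) {U : ℝ} (hU : 0 ≤ U) (μ : ℝ) {L : ℕ} (hL : 1 ≤ L)
    {m : ℕ} (hm : m < L * L) :
    gcEnergyDensityTT' t t' U μ * (L : ℝ) ^ 2 - (16 * |t| + 32 * |t'|) * L ≤
      groundEnergy (hubbardRectTorusTT' L L t t' U) (2 * m) - μ * ((2 * m : ℕ) : ℝ) := by
  have hLpos : (0 : ℝ) < L := by exact_mod_cast hL
  have hL2 : (0 : ℝ) < (L : ℝ) ^ 2 := by positivity
  set x : ℝ := ((2 * m : ℕ) : ℝ) / (L : ℝ) ^ 2 with hx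
  have hx0 : 0 ≤ x := by positivity
  have hx2 : x < 2 := by
    rw [hx, div_lt_iff₀ hL2]
    have : ((2 * m : ℕ) : ℝ) < 2 * (L * L : ℕ) := by exact_mod_cast (by omega : 2 * m < 2 * (L * L))
    push_cast at this ⊢; nlinarith
  have htile := energyDensityTT'_le t t' hU hL hm
  have hgc := gcEnergyDensityTT'_le t t' hU μ hx0 hx2
  -- `p ≤ E/L² + c/L − μ x`; multiply by `L²`
  have hxL : x * (L : ℝ) ^ 2 = ((2 * m : ℕ) : ℝ) := by rw [hx, div_mul_cancel₀ _ hL2.ne']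
  have h1 : gcEnergyDensityTT' t t' U μ ≤
      groundEnergy (hubbardRectTorusTT' L L t t' U) (2 * m) / (L : ℝ) ^ 2 + (16 * |t| + 32 * |t'|) / L -
        μ * x := by linarith
  have h2 := mul_le_mul_of_nonneg_right h1 hL2.le
  have i1 : groundEnergy (hubbardRectTorusTT' L L t t' U) (2 * m) / (L : ℝ) ^ 2 * (L : ℝ) ^ 2 =
      groundEnergy (hubbardRectTorusTT' L L t t' U) (2 * m) := div_mul_cancel₀ _ hL2.ne'
  have i2 : (16 * |t| + 32 * |t'|) / (L : ℝ) * (L : ℝ) ^ 2 = (16 * |t| + 32 * |t'|) * L := by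
    rw [pow_two, ← mul_assoc, div_mul_cancel₀ _ hLpos.ne']
  have e1 : (groundEnergy (hubbardRectTorusTT' L L t t' U) (2 * m) / (L : ℝ) ^ 2 +
      (16 * |t| + 32 * |t'|) / L - μ * x) * (L : ℝ) ^ 2 =
      groundEnergy (hubbardRectTorusTT' L L t t' U) (2 * m) + (16 * |t| + 32 * |t'|) * L -
        μ * ((2 * m : ℕ) : ℝ) := by
    rw [← hxL]
    calc (groundEnergy (hubbardRectTorusTT' L L t t' U) (2 * m) / (L : ℝ) ^ 2 +
          (16 * |t| + 32 * |t'|) / L - μ * x) * (L : ℝ) ^ 2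
        = groundEnergy (hubbardRectTorusTT' L L t t' U) (2 * m) / (L : ℝ) ^ 2 * (L : ℝ) ^ 2 +
            (16 * |t| + 32 * |t'|) / (L : ℝ) * (L : ℝ) ^ 2 - μ * (x * (L : ℝ) ^ 2) := by ring
      _ = _ := by rw [i1, i2]
  rw [e1] at h2
  linarith

/-- **«gcFloor» on the rectangular torus**: for every `μ`, `L ≥ 1` and EVERY sector `M ≤ 2L²`,
`p(μ) L² − (16|t| + 32|t'|) L − (54(2|t| + |U| + 2|t'|) + 2|μ|) ≤ E_{L×L}(M) − μM`. Even `M < 2L²`: the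
even-sector floor; odd `M ≤ L² − 1`: add one particle (`E(M+1) ≤ E(M) + 2K`); odd `M ≥ L²`: remove one
(`E(M−1) ≤ E(M) + 2K`); `M = 2L²`: remove two (`E(2L²−2) ≤ E(2L²) + 3K`), `K = 18(2|t|+|U|+2|t'|)`.
[cite: Ruelle1969, §3.4] -/
theorem gcFloor_hubbardRectTorusTT' (t t' : ℝ) {U : ℝ} (hU : 0 ≤ U) (μ : ℝ) {L : ℕ} (hL : 1 ≤ L)
    {M : ℕ} (hM : M ≤ 2 * L ^ 2) :
    gcEnergyDensityTT' t t' U μ * (L : ℝ) ^ 2 - (16 * |t| + 32 * |t'|) * L -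
        (54 * (2 * |t| + |U| + 2 * |t'|) + 2 * |μ|) ≤
      groundEnergy (hubbardRectTorusTT' L L t t' U) M - μ * M := by
  set E : ℕ → ℝ := fun N => groundEnergy (hubbardRectTorusTT' L L t t' U) N with hE
  set K : ℝ := 18 * (2 * |t| + |U| + 2 * |t'|) with hK
  set P : ℝ := gcEnergyDensityTT' t t' U μ * (L : ℝ) ^ 2 - (16 * |t| + 32 * |t'|) * L with hP
  have hK0 : 0 ≤ K := by positivity
  have hμ : μ ≤ |μ| := le_abs_self μ
  have hμ' : -μ ≤ |μ| := neg_le_abs μ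
  have hLpos : (0 : ℝ) < L := by exact_mod_cast hL
  have hL1r : (1 : ℝ) ≤ L := by exact_mod_cast hL
  have hL2 : (1 : ℝ) ≤ (L : ℝ) ^ 2 := by nlinarith [hL1r]
  have hLL : L ^ 2 = L * L := sq L
  -- the even-sector floor, in the form `P ≤ E(2m) − μ(2m)`
  have heven : ∀ m : ℕ, m < L * L → P ≤ E (2 * m) - μ * ((2 * m : ℕ) : ℝ) := fun m hm =>
    gcFloor_hubbardRectTorusTT'_even t t' hU μ hL hm
  show P - (54 * (2 * |t| + |U| + 2 * |t'|) + 2 * |μ|) ≤ E M - μ * M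
  have h3K : 54 * (2 * |t| + |U| + 2 * |t'|) = 3 * K := by rw [hK]; ring
  rw [h3K]
  obtain ⟨m, rfl | rfl⟩ := Nat.even_or_odd' M
  · -- even `M = 2m`
    by_cases hm : m < L * L
    · have h := heven m hm
      have : μ * (((2 * m : ℕ) : ℝ)) = μ * ((2 * m : ℕ) : ℝ) := rfl
      push_cast at h ⊢
      nlinarith [h, hK0, abs_nonneg μ]
    · -- the full band `2m = 2L²`
      have hmeq : m = L * L := by
        have : 2 * m ≤ 2 * (L * L) := by rw [← hLL]; exact hM
        omega
      subst hmeq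
      have hL1 : 1 ≤ L * L := Nat.one_le_iff_ne_zero.2 (by positivity)
      -- two removals: `E(2L²−1) ≤ E(2L²) + K`, `E(2L²−2) ≤ E(2L²−1) + 2K`
      have hr1 := groundEnergy_hubbardRectTorusTT'_square_pred_le L t t' U (N := 2 * (L * L)) (by omega)
        (by rw [hLL])
      have hr2 := groundEnergy_hubbardRectTorusTT'_square_pred_le L t t' U (N := 2 * (L * L) - 1) (by omega)
        (by rw [hLL]; omega)
      have hcast1 : ((2 * (L * L) : ℕ) : ℝ) = 2 * (L : ℝ) ^ 2 := by push_cast; ring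
      have hcast2 : ((2 * (L * L) - 1 : ℕ) : ℝ) = 2 * (L : ℝ) ^ 2 - 1 := by
        rw [Nat.cast_sub (by omega)]; push_cast; ring
      have hb1 : K * (2 * (L : ℝ) ^ 2) / ((2 * (L * L) : ℕ) : ℝ) = K := by
        rw [hcast1]; field_simp
      have hb2 : K * (2 * (L : ℝ) ^ 2) / ((2 * (L * L) - 1 : ℕ) : ℝ) ≤ 2 * K := by
        rw [hcast2, div_le_iff₀ (by nlinarith)]
        nlinarith
      rw [← hK, hb1] at hr1
      rw [← hK] at hr2
      have hsub : 2 * (L * L) - 1 - 1 = 2 * (L * L - 1) := by omega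
      rw [hsub] at hr2
      have hev := heven (L * L - 1) (by omega)
      have hcast3 : ((2 * (L * L - 1) : ℕ) : ℝ) = 2 * (L : ℝ) ^ 2 - 2 := by
        rw [Nat.cast_mul, Nat.cast_sub hL1]; push_cast; ring
      rw [hcast3] at hev
      rw [hcast1]
      nlinarith [hev, hr1, hr2, hb2, hμ, hμ', hK0]
  · -- odd `M = 2m + 1`
    by_cases hlow : 2 * m + 1 + 1 ≤ L * L
    · -- add one particle: `E(2m+2) ≤ E(2m+1) + 2K`
      have hadd := groundEnergy_hubbardRectTorusTT'_square_add_le L t t' U (n := 1) one_lt_two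
        (N := 2 * m + 1) (d := 1) (by
          have : ((2 * m + 1 + 1 : ℕ) : ℝ) ≤ ((L * L : ℕ) : ℝ) := by exact_mod_cast hlow
          push_cast at this ⊢; nlinarith)
      have hK2 : (1 : ℕ) * (36 * (2 * |t| + |U| + 2 * |t'|) / (2 - 1)) = 2 * K := by
        rw [hK]; push_cast; ring
      rw [hK2] at hadd
      have hev := heven (m + 1) (by omega)
      have hcast : ((2 * (m + 1) : ℕ) : ℝ) = ((2 * m + 1 : ℕ) : ℝ) + 1 := by push_cast; ring
      rw [show 2 * m + 1 + 1 = 2 * (m + 1) by ring] at hadd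
      rw [hcast] at hev
      nlinarith [hev, hadd, hμ, hμ', hK0]
    · -- remove one particle: `E(2m) ≤ E(2m+1) + 2K` (`2m + 1 ≥ L²`)
      have hge : L * L ≤ 2 * m + 1 := by omega
      have hr := groundEnergy_hubbardRectTorusTT'_square_pred_le L t t' U (N := 2 * m + 1) (by omega) hM
      have hcast : ((2 * m + 1 : ℕ) : ℝ) = 2 * (m : ℝ) + 1 := by push_cast; ring
      have hb : K * (2 * (L : ℝ) ^ 2) / ((2 * m + 1 : ℕ) : ℝ) ≤ 2 * K := by
        have hpos : (0 : ℝ) < ((2 * m + 1 : ℕ) : ℝ) := by positivity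
        rw [div_le_iff₀ hpos]
        have : ((L * L : ℕ) : ℝ) ≤ ((2 * m + 1 : ℕ) : ℝ) := by exact_mod_cast hge
        push_cast at this
        nlinarith [this, hK0]
      rw [← hK, show 2 * m + 1 - 1 = 2 * m by omega] at hr
      have hev := heven m (by
        have : 2 * m + 1 ≤ 2 * (L * L) := by rw [← hLL]; exact hM
        omega)
      have hcast' : ((2 * m : ℕ) : ℝ) = 2 * (m : ℝ) := by push_cast; ring
      rw [hcast'] at hev
      rw [hcast] at hb ⊢
      rw [hcast] at hr
      nlinarith [hev, hr, hb, hμ, hμ', hK0]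

/-- **«gcFloor» on the square torus `(ℤ/Lℤ)²`** (`hubbardTorusTT' L`, the venture's torus; sector energies
equal those of the rectangular torus, `groundEnergy_hubbardTorusTT'_eq_rect`): for every `μ`, `L ≥ 1`,
`M ≤ 2L²`, `p(μ) L² − (16|t| + 32|t'|) L − (54(2|t| + |U| + 2|t'|) + 2|μ|) ≤ E_L(M) − μM` — an explicit-rate
statement, uniform in the sector, no limit taken. [cite: Ruelle1969, §3.4] -/
theorem gcFloor_hubbardTorusTT' (t t' : ℝ) {U : ℝ} (hU : 0 ≤ U) (μ : ℝ) {L : ℕ} (hL : 1 ≤ L)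
    {M : ℕ} (hM : M ≤ 2 * L ^ 2) :
    gcEnergyDensityTT' t t' U μ * (L : ℝ) ^ 2 - (16 * |t| + 32 * |t'|) * L -
        (54 * (2 * |t| + |U| + 2 * |t'|) + 2 * |μ|) ≤
      groundEnergy (hubbardTorusTT' L t t' U) M - μ * M := by
  rw [groundEnergy_hubbardTorusTT'_eq_rect]
  exact gcFloor_hubbardRectTorusTT' t t' hU μ hL hM

/-- `|Orb (FermionTorus 2 L)| = 2L²`. [folklore] -/
private theorem card_orb_fermionTorus_two (L : ℕ) : Fintype.card (Orb (FermionTorus 2 L)) = 2 * L ^ 2 := by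
  rw [card_orb]
  simp [FermionTorus, Fintype.card_lex]

/-- **«gcFloor», Fock-space form**: for every vector `ψ` of the Fock space of the `L × L` torus (any particle
content), `(p(μ)L² − (16|t|+32|t'|)L − (54(2|t|+|U|+2|t'|) + 2|μ|)) · ⟨ψ,ψ⟩ ≤ Re⟨ψ, (H_L − μN̂)ψ⟩`.
[cite: Ruelle1969, §3.4] -/
theorem gcFloor_hubbardTorusTT'_re_dotProduct (t t' : ℝ) {U : ℝ} (hU : 0 ≤ U) (μ : ℝ) {L : ℕ}
    (hL : 1 ≤ L) (ψ : Fock (Orb (FermionTorus 2 L))) :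
    (gcEnergyDensityTT' t t' U μ * (L : ℝ) ^ 2 - (16 * |t| + 32 * |t'|) * L -
        (54 * (2 * |t| + |U| + 2 * |t'|) + 2 * |μ|)) * (star ψ ⬝ᵥ ψ).re ≤
      (star ψ ⬝ᵥ ((hubbardTorusTT' L t t' U -
        (μ : ℂ) • (totalNumber : Matrix (Finset (Orb (FermionTorus 2 L))) (Finset (Orb (FermionTorus 2 L))) ℂ))
          *ᵥ ψ)).re := by
  refine mul_re_dotProduct_le_re_dotProduct_gc_of_forall_sector (hubbardTorusTT' L t t' U)
    (hubbardTorusTT'_commute_totalNumber L t t' U) μ _ (fun N hN => ?_) ψ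
  rw [mem_range, card_orb_fermionTorus_two, Nat.lt_succ_iff] at hN
  exact gcFloor_hubbardTorusTT' t t' hU μ hL hN

/-- **«gcFloor», unit-vector form** (the `hfloor` hypothesis of
`VariationalStationarity.abs_im_expect_commutator_le_sqrt` with `Q = 1`, `q = 1`): for every UNIT vector
`χ` of the Fock space of the torus, `p(μ)L² − (16|t|+32|t'|)L − (54(2|t|+|U|+2|t'|) + 2|μ|) ≤ Re⟨χ,(H_L − μN̂)χ⟩`.
[cite: Ruelle1969, §3.4] -/
theorem gcFloor_hubbardTorusTT'_unit (t t' : ℝ) {U : ℝ} (hU : 0 ≤ U) (μ : ℝ) {L : ℕ} (hL : 1 ≤ L)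
    (χ : Fock (Orb (FermionTorus 2 L))) (hχ : star χ ⬝ᵥ χ = 1) :
    gcEnergyDensityTT' t t' U μ * (L : ℝ) ^ 2 - (16 * |t| + 32 * |t'|) * L -
        (54 * (2 * |t| + |U| + 2 * |t'|) + 2 * |μ|) ≤
      (star χ ⬝ᵥ ((hubbardTorusTT' L t t' U -
        (μ : ℂ) • (totalNumber : Matrix (Finset (Orb (FermionTorus 2 L))) (Finset (Orb (FermionTorus 2 L))) ℂ))
          *ᵥ χ)).re := by
  have h := gcFloor_hubbardTorusTT'_re_dotProduct t t' hU μ hL χ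
  rwa [hχ, Complex.one_re, mul_one] at h

/-- **«gcFloor» for the grand-canonical ground energy** `E₀(H_L − μN̂)` (least eigenvalue on the full Fock
space): `p(μ)L² − (16|t|+32|t'|)L − (54(2|t|+|U|+2|t'|) + 2|μ|) ≤ E₀(hubbardTorusTT' L t t' U − μN̂)`.
[cite: Ruelle1969, §3.4] -/
theorem gcFloor_le_groundEnergy_hubbardTorusTT'_gc (t t' : ℝ) {U : ℝ} (hU : 0 ≤ U) (μ : ℝ) {L : ℕ}
    (hL : 1 ≤ L) :
    gcEnergyDensityTT' t t' U μ * (L : ℝ) ^ 2 - (16 * |t| + 32 * |t'|) * L -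
        (54 * (2 * |t| + |U| + 2 * |t'|) + 2 * |μ|) ≤
      Matrix.groundEnergy (hubbardTorusTT' L t t' U -
        (μ : ℂ) • (totalNumber : Matrix (Finset (Orb (FermionTorus 2 L))) (Finset (Orb (FermionTorus 2 L))) ℂ)) := by
  -- via the generic lemma; `convert` identifies the `DecidableEq` instance paths of `Matrix.groundEnergy`
  -- propositionally (as `HubbardGrandCanonicalDensity` does for `hubbardTorusWith`)
  have h := le_groundEnergy_gc_of_forall_sector (hubbardTorusTT' L t t' U) (hubbardTorusTT'_isHermitian L t t' U)
    (hubbardTorusTT'_commute_totalNumber L t t' U) μ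
    (gcEnergyDensityTT' t t' U μ * (L : ℝ) ^ 2 - (16 * |t| + 32 * |t'|) * L -
        (54 * (2 * |t| + |U| + 2 * |t'|) + 2 * |μ|)) (fun N hN => by
      rw [mem_range, card_orb_fermionTorus_two, Nat.lt_succ_iff] at hN
      exact gcFloor_hubbardTorusTT' t t' hU μ hL hN)
  convert h using 2

/-- **The grand-canonical ground energy of the torus lies below every sector**: for `0 ≤ m ≤ 2`,
`E₀(hubbardTorusTT' L t t' U − μN̂) ≤ E_L(rectN m L) − μ · rectN m L` (the sector `rectN m L = 2⌊mL²/2⌋ ≤ 2L²`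
is non-empty). [cite: Tasaki2020, §2.1] -/
theorem groundEnergy_hubbardTorusTT'_gc_le_rectN (t t' U μ : ℝ) (L : ℕ) {m : ℝ} (hm0 : 0 ≤ m)
    (hm2 : m ≤ 2) :
    Matrix.groundEnergy (hubbardTorusTT' L t t' U -
        (μ : ℂ) • (totalNumber : Matrix (Finset (Orb (FermionTorus 2 L))) (Finset (Orb (FermionTorus 2 L))) ℂ)) ≤
      groundEnergy (hubbardTorusTT' L t t' U) (rectN m L) - μ * (rectN m L : ℕ) := by
  have h := groundEnergy_gc_le_sector (hubbardTorusTT' L t t' U) (hubbardTorusTT'_isHermitian L t t' U) μ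
    (N := rectN m L) (by
      rw [card_orb_fermionTorus_two, sq]
      exact rectN_le_two_mul hm0 hm2 L)
  convert h using 2

end Torus

/-! ### §3 The thermodynamic limit of the grand-canonical ground-state energy per site -/

section Limit

/-- `L ↦ (L : ℝ)²` tends to `+∞` along the naturals. [folklore] -/
private theorem tendsto_natCast_sq_atTop : Tendsto (fun L : ℕ => (L : ℝ) ^ 2) atTop atTop := by
  have h := (tendsto_pow_atTop (α := ℝ) two_ne_zero).comp tendsto_natCast_atTop_atTop
  exact h.congr fun L => by simp [Function.comp_apply]

/-- **The thermodynamic limit of the grand-canonical ground-state energy per site of the `t–t'` Hubbard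
torus is the Legendre transform of the energy density**: for `U ≥ 0` and every `μ`,
`E₀(hubbardTorusTT' L t t' U − μN̂)/L² → p(t,t',U,μ) = inf_{0 ≤ m < 2} (e(m) − μm)` as `L → ∞`
(floor: `gcFloor_le_groundEnergy_hubbardTorusTT'_gc`, error `O(1/L)`; ceiling: the sector `rectN m L` of a
near-minimising density `m`, `tendsto_energyDensityTT'_torus`). [cite: Ruelle1969, §3.4] -/
theorem tendsto_groundEnergy_gc_hubbardTorusTT'_div_sq (t t' : ℝ) {U : ℝ} (hU : 0 ≤ U) (μ : ℝ) :
    Tendsto (fun L : ℕ => Matrix.groundEnergy (hubbardTorusTT' L t t' U -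
        (μ : ℂ) • (totalNumber : Matrix (Finset (Orb (FermionTorus 2 L))) (Finset (Orb (FermionTorus 2 L))) ℂ)) /
          (L : ℝ) ^ 2) atTop (𝓝 (gcEnergyDensityTT' t t' U μ)) := by
  set p := gcEnergyDensityTT' t t' U μ with hp
  set c : ℝ := 16 * |t| + 32 * |t'| with hc
  set C : ℝ := 54 * (2 * |t| + |U| + 2 * |t'|) + 2 * |μ| with hC
  set g : ℕ → ℝ := fun L => Matrix.groundEnergy (hubbardTorusTT' L t t' U -
        (μ : ℂ) • (totalNumber : Matrix (Finset (Orb (FermionTorus 2 L))) (Finset (Orb (FermionTorus 2 L))) ℂ)) /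
          (L : ℝ) ^ 2 with hg
  rw [tendsto_order]
  refine ⟨fun a ha => ?_, fun b hb => ?_⟩
  · -- eventually `a < g L`: the floor `p − c/L − C/L² ≤ g L`
    have hlow : Tendsto (fun L : ℕ => p - c / L - C / (L : ℝ) ^ 2) atTop (𝓝 p) := by
      have h1 : Tendsto (fun L : ℕ => c / (L : ℝ)) atTop (𝓝 0) :=
        tendsto_const_nhds.div_atTop tendsto_natCast_atTop_atTop
      have h2 : Tendsto (fun L : ℕ => C / (L : ℝ) ^ 2) atTop (𝓝 0) :=
        tendsto_const_nhds.div_atTop tendsto_natCast_sq_atTop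
      simpa using (tendsto_const_nhds.sub h1).sub h2
    have hev := (tendsto_order.1 hlow).1 a ha
    filter_upwards [hev, eventually_ge_atTop 1] with L hL hL1
    have hLpos : (0 : ℝ) < L := by exact_mod_cast hL1
    have hL2 : (0 : ℝ) < (L : ℝ) ^ 2 := by positivity
    have hfl := gcFloor_le_groundEnergy_hubbardTorusTT'_gc t t' hU μ hL1
    refine hL.trans_le ?_
    simp only [hg]
    rw [le_div_iff₀ hL2]
    have j1 : c / (L : ℝ) * (L : ℝ) ^ 2 = c * L := by
      rw [pow_two, ← mul_assoc, div_mul_cancel₀ _ hLpos.ne']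
    have j2 : C / (L : ℝ) ^ 2 * (L : ℝ) ^ 2 = C := div_mul_cancel₀ _ hL2.ne'
    have e : (p - c / L - C / (L : ℝ) ^ 2) * (L : ℝ) ^ 2 = p * (L : ℝ) ^ 2 - c * L - C := by
      calc (p - c / L - C / (L : ℝ) ^ 2) * (L : ℝ) ^ 2
          = p * (L : ℝ) ^ 2 - c / (L : ℝ) * (L : ℝ) ^ 2 - C / (L : ℝ) ^ 2 * (L : ℝ) ^ 2 := by ring
        _ = _ := by rw [j1, j2]
    rw [e]
    exact hfl
  · -- eventually `g L < b`: a density `m` with `e(m) − μm < b`, then the sector `rectN m L`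
    obtain ⟨_, ⟨m, ⟨hm0, hm2⟩, rfl⟩, hmb⟩ :=
      exists_lt_of_csInf_lt (⟨_, ⟨0, ⟨le_rfl, two_pos⟩, rfl⟩⟩ :
        ((fun m : ℝ => energyDensityTT' t t' U m - μ * m) '' Set.Ico 0 2).Nonempty) hb
    simp only at hmb
    have hsec : Tendsto (fun L : ℕ => groundEnergy (hubbardTorusTT' L t t' U) (rectN m L) / (L : ℝ) ^ 2 -
        μ * ((rectN m L : ℝ) / (L : ℝ) ^ 2)) atTop (𝓝 (energyDensityTT' t t' U m - μ * m)) :=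
      (tendsto_energyDensityTT'_torus t t' hU hm0 hm2).sub (tendsto_const_nhds.mul (tendsto_rectN_div_sq hm0))
    have hev := (tendsto_order.1 hsec).2 b hmb
    filter_upwards [hev, eventually_ge_atTop 1] with L hL hL1
    have hLpos : (0 : ℝ) < L := by exact_mod_cast hL1
    have hL2 : (0 : ℝ) < (L : ℝ) ^ 2 := by positivity
    refine lt_of_le_of_lt ?_ hL
    have hle := groundEnergy_hubbardTorusTT'_gc_le_rectN t t' U μ L hm0 hm2.le
    simp only [hg]
    rw [← mul_div_assoc, ← sub_div, div_le_div_iff_of_pos_right hL2]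
    exact hle

/-- **The `t' = 0` grand-canonical torus of the tree**: for `U ≥ 0` and every `μ`,
`E₀(hubbardTorusWith 2 L t U μ)/L² → p(t,0,U,μ) = inf_{0 ≤ m < 2} (energyDensity2D t U m − μm)`
(`hubbardTorusWith = hubbardTorus − μN̂ = hubbardTorusTT' L t 0 U − μN̂`). This is the hypothesis shape of
`HubbardGrandCanonicalDensity.tendsto_gcDensity_of_hasDerivAt` (along `L + 1`, with `e = p(t,0,U,·)`),
whose remaining input is the differentiability of the concave `p` at `μ`. [cite: Ruelle1969, §3.4] -/
theorem tendsto_groundEnergy_hubbardTorusWith_div_sq (t : ℝ) {U : ℝ} (hU : 0 ≤ U) (μ : ℝ) :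
    Tendsto (fun L : ℕ => Matrix.groundEnergy (hubbardTorusWith 2 L t U μ) / (L : ℝ) ^ 2) atTop
      (𝓝 (gcEnergyDensityTT' t 0 U μ)) := by
  refine (tendsto_groundEnergy_gc_hubbardTorusTT'_div_sq t 0 hU μ).congr fun L => ?_
  rw [hubbardTorusWith_eq, ← hubbardTorusTT'_zero]

/-- The same limit along `L + 1` (the indexing of `tendsto_gcDensity_of_hasDerivAt`). [cite: Ruelle1969, §3.4] -/
theorem tendsto_groundEnergy_hubbardTorusWith_succ_div_sq (t : ℝ) {U : ℝ} (hU : 0 ≤ U) (μ : ℝ) :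
    Tendsto (fun L : ℕ => Matrix.groundEnergy (hubbardTorusWith 2 (L + 1) t U μ) / ((L : ℝ) + 1) ^ 2) atTop
      (𝓝 (gcEnergyDensityTT' t 0 U μ)) := by
  have h := (tendsto_groundEnergy_hubbardTorusWith_div_sq t hU μ).comp (tendsto_add_atTop_nat 1)
  refine h.congr fun L => ?_
  simp only [Function.comp_apply, Nat.cast_add, Nat.cast_one]

end Limit

/-! ### §4 At a supporting slope: the floor in terms of `e(n) − μ n` -/

section Slope

open Set

/-- **`p(μ) = e(n) − μn` on the subdifferential**: if `n ∈ [0, 2)` minimises `x ↦ e(x) − μx` on `[0, 2)`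
then the infimum `p(μ)` is attained at `n` (`U ≥ 0`). [cite: Ruelle1969, §3.4] -/
theorem gcEnergyDensityTT'_eq_of_isMinOn (t t' : ℝ) {U : ℝ} (hU : 0 ≤ U) {n μ : ℝ} (hn0 : 0 ≤ n)
    (hn2 : n < 2) (hmin : IsMinOn (fun x => energyDensityTT' t t' U x - μ * x) (Ico (0 : ℝ) 2) n) :
    gcEnergyDensityTT' t t' U μ = energyDensityTT' t t' U n - μ * n := by
  refine le_antisymm (gcEnergyDensityTT'_le t t' hU μ hn0 hn2) (le_gcEnergyDensityTT' fun m hm0 hm2 => ?_)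
  have h := hmin (show m ∈ Ico (0 : ℝ) 2 from ⟨hm0, hm2⟩)
  simp only [mem_setOf_eq] at h
  linarith

/-- **`p(μ) = e(n) − μn` for `μ ∈ [μ₋(n), μ₊(n)]`** (`0 < n < 2`, `U ≥ 0`; the ensemble dictionary
`mem_Icc_chemPot_iff_isMinOn`): at every chemical potential of the subdifferential of the convex `e` at `n`,
the grand potential is the value of the supporting line at density `0`… i.e. Fenchel–Young holds with
equality. [cite: Ruelle1969, §3.4] -/
theorem gcEnergyDensityTT'_eq_of_mem_Icc_chemPot (t t' : ℝ) {U : ℝ} (hU : 0 ≤ U) {n μ : ℝ} (hn0 : 0 < n)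
    (hn2 : n < 2) (hμ : μ ∈ Icc (chemPotMinusTT' t t' U n) (chemPotPlusTT' t t' U n)) :
    gcEnergyDensityTT' t t' U μ = energyDensityTT' t t' U n - μ * n :=
  gcEnergyDensityTT'_eq_of_isMinOn t t' hU hn0.le hn2 (isMinOn_sub_mul_of_mem_Icc_chemPot t t' hU hn0 hn2 hμ)

/-- **`p(μ) = e(n) − μn` from a supporting line** stated as an inequality family (the form produced by
`exists_supporting_line_energyDensity2D`-type lemmas): if `e(n) + μ(x − n) ≤ e(x)` for all `x ∈ [0, 2)`
then `p(μ) = e(n) − μn` (`0 ≤ n < 2`, `U ≥ 0`). [cite: Ruelle1969, §3.4] -/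
theorem gcEnergyDensityTT'_eq_of_supporting_line (t t' : ℝ) {U : ℝ} (hU : 0 ≤ U) {n μ : ℝ} (hn0 : 0 ≤ n)
    (hn2 : n < 2)
    (hline : ∀ x ∈ Ico (0 : ℝ) 2, energyDensityTT' t t' U n + μ * (x - n) ≤ energyDensityTT' t t' U x) :
    gcEnergyDensityTT' t t' U μ = energyDensityTT' t t' U n - μ * n := by
  refine gcEnergyDensityTT'_eq_of_isMinOn t t' hU hn0 hn2 fun x hx => ?_
  have h := hline x hx
  show energyDensityTT' t t' U n - μ * n ≤ energyDensityTT' t t' U x - μ * x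
  linarith

/-- **«gcFloor» at a supporting slope** (the form used by the charged-stationarity argument): for
`0 < n < 2`, `U ≥ 0`, `μ ∈ [μ₋(n), μ₊(n)]`, `L ≥ 1` and every sector `M ≤ 2L²`,
`(e(n) − μn) L² − (16|t| + 32|t'|) L − (54(2|t| + |U| + 2|t'|) + 2|μ|) ≤ E_L(M) − μM`. [cite: Ruelle1969, §3.4] -/
theorem gcFloor_hubbardTorusTT'_of_mem_Icc_chemPot (t t' : ℝ) {U : ℝ} (hU : 0 ≤ U) {n μ : ℝ}
    (hn0 : 0 < n) (hn2 : n < 2) (hμ : μ ∈ Icc (chemPotMinusTT' t t' U n) (chemPotPlusTT' t t' U n))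
    {L : ℕ} (hL : 1 ≤ L) {M : ℕ} (hM : M ≤ 2 * L ^ 2) :
    (energyDensityTT' t t' U n - μ * n) * (L : ℝ) ^ 2 - (16 * |t| + 32 * |t'|) * L -
        (54 * (2 * |t| + |U| + 2 * |t'|) + 2 * |μ|) ≤
      groundEnergy (hubbardTorusTT' L t t' U) M - μ * M := by
  rw [← gcEnergyDensityTT'_eq_of_mem_Icc_chemPot t t' hU hn0 hn2 hμ]
  exact gcFloor_hubbardTorusTT' t t' hU μ hL hM

/-- **«gcFloor» at a supporting slope, unit-vector form**: for `0 < n < 2`, `U ≥ 0`,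
`μ ∈ [μ₋(n), μ₊(n)]`, `L ≥ 1` and every unit vector `χ` of the Fock space of the torus,
`(e(n) − μn) L² − (16|t| + 32|t'|) L − (54(2|t| + |U| + 2|t'|) + 2|μ|) ≤ Re⟨χ, (H_L − μN̂) χ⟩`.
[cite: Ruelle1969, §3.4] -/
theorem gcFloor_hubbardTorusTT'_unit_of_mem_Icc_chemPot (t t' : ℝ) {U : ℝ} (hU : 0 ≤ U) {n μ : ℝ}
    (hn0 : 0 < n) (hn2 : n < 2) (hμ : μ ∈ Icc (chemPotMinusTT' t t' U n) (chemPotPlusTT' t t' U n))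
    {L : ℕ} (hL : 1 ≤ L) (χ : Fock (Orb (FermionTorus 2 L))) (hχ : star χ ⬝ᵥ χ = 1) :
    (energyDensityTT' t t' U n - μ * n) * (L : ℝ) ^ 2 - (16 * |t| + 32 * |t'|) * L -
        (54 * (2 * |t| + |U| + 2 * |t'|) + 2 * |μ|) ≤
      (star χ ⬝ᵥ ((hubbardTorusTT' L t t' U -
        (μ : ℂ) • (totalNumber : Matrix (Finset (Orb (FermionTorus 2 L))) (Finset (Orb (FermionTorus 2 L))) ℂ))
          *ᵥ χ)).re := by
  rw [← gcEnergyDensityTT'_eq_of_mem_Icc_chemPot t t' hU hn0 hn2 hμ]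
  exact gcFloor_hubbardTorusTT'_unit t t' hU μ hL χ hχ

/-- **The excess of an almost-canonical vector over the global grand-canonical floor is controlled by
its canonical energy and number defects** (the quantitative input of Pusz–Woronowicz for CHARGED
perturbations): for `0 < n < 2`, `U ≥ 0`, `μ ∈ [μ₋(n), μ₊(n)]`, `L ≥ 1`, a vector `χ` of the torus Fock
space with `Re⟨χ, H_L χ⟩ ≤ E` and `Re⟨χ, N̂ χ⟩ = ν` has
`Re⟨χ, (H_L − μN̂)χ⟩ − E₀(H_L − μN̂) ≤ (E − e(n)L²) − μ(ν − nL²) + (16|t| + 32|t'|)L + (54(2|t|+|U|+2|t'|) + 2|μ|)`;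
for a unit `χ` with `E = e(n)L² + o(L²)` and `ν = nL² + O(1)` the right side is `o(L²)`.
[cite: Ruelle1969, §3.4] -/
theorem re_dotProduct_gc_sub_groundEnergy_le_of_mem_Icc_chemPot (t t' : ℝ) {U : ℝ} (hU : 0 ≤ U)
    {n μ : ℝ} (hn0 : 0 < n) (hn2 : n < 2)
    (hμ : μ ∈ Icc (chemPotMinusTT' t t' U n) (chemPotPlusTT' t t' U n)) {L : ℕ} (hL : 1 ≤ L)
    (χ : Fock (Orb (FermionTorus 2 L))) {E ν : ℝ}
    (hE : (star χ ⬝ᵥ (hubbardTorusTT' L t t' U *ᵥ χ)).re ≤ E)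
    (hν : (star χ ⬝ᵥ ((totalNumber : Matrix (Finset (Orb (FermionTorus 2 L)))
      (Finset (Orb (FermionTorus 2 L))) ℂ) *ᵥ χ)).re = ν) :
    (star χ ⬝ᵥ ((hubbardTorusTT' L t t' U -
        (μ : ℂ) • (totalNumber : Matrix (Finset (Orb (FermionTorus 2 L))) (Finset (Orb (FermionTorus 2 L))) ℂ))
          *ᵥ χ)).re -
      Matrix.groundEnergy (hubbardTorusTT' L t t' U -
        (μ : ℂ) • (totalNumber : Matrix (Finset (Orb (FermionTorus 2 L))) (Finset (Orb (FermionTorus 2 L))) ℂ)) ≤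
      (E - energyDensityTT' t t' U n * (L : ℝ) ^ 2) - μ * (ν - n * (L : ℝ) ^ 2) +
        (16 * |t| + 32 * |t'|) * L + (54 * (2 * |t| + |U| + 2 * |t'|) + 2 * |μ|) := by
  have hfl := gcFloor_le_groundEnergy_hubbardTorusTT'_gc t t' hU μ hL
  rw [gcEnergyDensityTT'_eq_of_mem_Icc_chemPot t t' hU hn0 hn2 hμ] at hfl
  have hsplit : (star χ ⬝ᵥ ((hubbardTorusTT' L t t' U -
        (μ : ℂ) • (totalNumber : Matrix (Finset (Orb (FermionTorus 2 L))) (Finset (Orb (FermionTorus 2 L))) ℂ))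
          *ᵥ χ)).re = (star χ ⬝ᵥ (hubbardTorusTT' L t t' U *ᵥ χ)).re - μ * ν := by
    rw [sub_mulVec, smul_mulVec, dotProduct_sub, dotProduct_smul, Complex.sub_re, smul_eq_mul,
      Complex.re_ofReal_mul, hν]
  rw [hsplit]
  nlinarith [hfl, hE]

end Slope

end ThermodynamicLimit

end Literature.MathematicalPhysics.QuantumLattice

end
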